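import Mathlib
import Literature.NumberTheory.Transcendental.ZagierDilogarithmConjecture
import Literature.NumberTheory.Transcendental.BlochWignerDilogarithm
import Literature.NumberTheory.Transcendental.PreBlochGroup
import Literature.NumberTheory.Transcendental.BlochGroupRegulator
import Summits.KontsevichZagierPeriods.KontsevichZagierPeriods.Theorems.ZagierDilogarithmConjecture.Negative.DehnInvariant
import HarnessLib

/-!
# `ZagierDilogarithmConjecture` (stmt-KontsevichZagierPeriods-10550) — line
`kummer-clausen-linearisation` (generation 2), stub `stub_numberFieldDescent`

**Descent to a number field.** Under the Borel–Suslin fact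
(`Borel1977_blochGroup_regulator_kernel_torsion`: on the Bloch group of a number field the Borel
regulator `(D ∘ σ)_σ` has torsion kernel, Neumann 1998 Thm. 3.2): if the formal combination
`ξ = Σ mᵢ[uᵢ]` of algebraic points of `ℍ⁺` has vanishing Dehn invariants `dehn φ ψ ξ = 0` (all
additive characters `φ, ψ : ℂˣ → ℚ`) and the anti-symmetrised regulator
`Σ mᵢ (D(σ uᵢ) − D(σ ūᵢ))` vanishes for every `ℚ`-embedding `σ : ℚ̄ → ℂ`, then a positive multiple
of `ξ` lies in the dilogarithm relator group `⟨dilogRelators⟩ ⊆ ℤ[ℂ]`.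

Proof. Work in `E = ℚ̄ ⊆ ℂ` (`algebraicClosure ℚ ℂ`) and in the number field `K = ℚ(uᵢ, ūᵢ) ⊆ E`;
`η = Σ mᵢ([uᵢ] − [ūᵢ]) ∈ ℤ⟨K ∖ {0,1}⟩`. (1) Every `ℚ`-character of `Kˣ` extends to `ℂˣ` (Baer:
`ℚ` is divisible), and the wedge pairing of the extensions restricted to `K` is minus the symbol
`sym` of `Negative/DehnInvariant`; so the Dehn hypothesis gives the Bloch condition for `η`.
(2) Every embedding `σ : K → ℂ` lands in `E` and lifts to `E →ₐ[ℚ] E` (`AlgHom.liftNormal`, `E/ℚ`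
normal), so the propagation hypothesis gives the vanishing of every regulator component of `η`.
(3) The fact yields `N ≥ 1` with `N • η` in the five-term span of `K`, which maps into
`⟨dilogRelators⟩`; finally `2ξ = η + Σ mᵢ([uᵢ] + [ūᵢ])`, so `(2N) • ξ ∈ ⟨dilogRelators⟩`.
-/

noncomputable section

open scoped ComplexConjugate
open Literature.NumberTheory.Transcendental
open Summit.KontsevichZagierPeriods.HyperbolicBloch.ZagierDilogarithmConjectureNegative
  (ext sym asym dehn dehn_of ext_of_ne)
open FreeAbelianGroup (of lift_apply_of)

namespace Summit.KontsevichZagierPeriods.HyperbolicBloch.ZagierDilogarithm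

/-! ## §1 Characters: extension from `Kˣ` to `ℂˣ` and comparison of the pairings -/

section characters

variable {K : Type*} [Field K] (f : K →+* ℂ)

/-- Every additive character `Kˣ → ℚ` extends along an embedding `K → ℂ` to a character of `ℂˣ`
(the divisible group `ℚ` is an injective `ℤ`-module, Baer). [folklore] -/
theorem exists_character_extension (uK : Additive Kˣ →+ ℚ) :
    ∃ φ : Additive ℂˣ →+ ℚ, ∀ x : Kˣ,
      φ (Additive.ofMul (Units.map (f : K →* ℂ) x)) = uK (Additive.ofMul x) := by
  have hinj : Function.Injective (MonoidHom.toAdditive (Units.map (f : K →* ℂ))) := by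
    intro a b hab
    have hab' : Units.map (f : K →* ℂ) (Additive.toMul a) = Units.map (f : K →* ℂ) (Additive.toMul b) :=
      hab
    exact congrArg Additive.ofMul (Units.map_injective f.injective hab')
  obtain ⟨φ, hφ⟩ := (Module.Baer.of_divisible ℚ).extension_property_addMonoidHom _ hinj uK
  exact ⟨φ, fun x => by simpa using DFunLike.congr_fun hφ (Additive.ofMul x)⟩

/-- `ext φ` at the image of a unit of `K` is the value of the restricted character. [folklore] -/
theorem ext_map_units {φ : Additive ℂˣ →+ ℚ} {uK : Additive Kˣ →+ ℚ}
    (hφ : ∀ x : Kˣ, φ (Additive.ofMul (Units.map (f : K →* ℂ) x)) = uK (Additive.ofMul x))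
    (x : Kˣ) : ext φ (f x) = uK (Additive.ofMul x) := by
  have hx : f (x : K) ≠ 0 := (map_ne_zero f).2 x.ne_zero
  rw [ext_of_ne φ hx, ← hφ x]
  congr 2
  ext
  simp

/-- **Comparison.** On a generator `z ∈ K ∖ {0,1}`, the wedge pairing of two characters of `Kˣ`
equals MINUS the symbol `sym` (of `Negative/DehnInvariant`) of their extensions to `ℂˣ` at
`f z`: `u(1 - z) v(z) - v(1 - z) u(z) = -(φ(z) ψ(1 - z) - ψ(z) φ(1 - z))`. [folklore] -/
theorem wedgePairing_of_eq_neg_sym {φ ψ : Additive ℂˣ →+ ℚ} {uK vK : Additive Kˣ →+ ℚ}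
    (hφ : ∀ x : Kˣ, φ (Additive.ofMul (Units.map (f : K →* ℂ) x)) = uK (Additive.ofMul x))
    (hψ : ∀ x : Kˣ, ψ (Additive.ofMul (Units.map (f : K →* ℂ) x)) = vK (Additive.ofMul x))
    (g : PreBloch.Gen K) :
    PreBloch.wedgePairing uK vK (of g) = -sym φ ψ (f g.val) := by
  rw [PreBloch.wedgePairing_of, ← ext_map_units f hφ, ← ext_map_units f hψ,
    ← ext_map_units f hφ, ← ext_map_units f hψ]
  simp only [PreBloch.Gen.val_unit, PreBloch.Gen.val_unitOneSub, map_sub, map_one, sym]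
  ring

end characters

/-! ## §2 Five-term relators of a subfield of `ℚ̄` push forward to dilogarithm relators -/

/-- For a field `K` with an embedding `f : K → ℂ` whose image consists of algebraic numbers, the
map `ι [g] = [f g]` sends the five-term relators of `ℤ⟨K ∖ {0,1}⟩` into `⟨dilogRelators⟩`.
[cite: Neumann1998, §2 eq. (2.3)] -/
theorem closure_fiveTerm_le_comap_of_embedding {K : Type*} [Field K] (f : K →+* ℂ)
    (hf : ∀ x : K, IsAlgebraic ℚ (f x))
    (ι : FreeAbelianGroup (PreBloch.Gen K) →+ FreeAbelianGroup ℂ)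
    (hι : ∀ g, ι (of g) = of (f g.val)) :
    AddSubgroup.closure (fiveTermRelators K) ≤ (AddSubgroup.closure dilogRelators).comap ι := by
  refine (AddSubgroup.closure_le _).2 ?_
  rintro r ⟨X, Y, hXY, rfl⟩
  simp only [SetLike.mem_coe, AddSubgroup.mem_comap, fiveTermRelator, map_add, map_sub, hι,
    PreBloch.Gen.val_quot, PreBloch.Gen.val_quotInv, PreBloch.Gen.val_quotSub, map_div₀, map_one,
    map_inv₀]
  have hx0 : f X.val ≠ 0 := (map_ne_zero f).2 X.val_ne_zero
  have hx1 : f X.val ≠ 1 := fun e => X.val_ne_one (f.injective (by rw [e, map_one]))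
  have hy0 : f Y.val ≠ 0 := (map_ne_zero f).2 Y.val_ne_zero
  have hy1 : f Y.val ≠ 1 := fun e => Y.val_ne_one (f.injective (by rw [e, map_one]))
  have hxy : f X.val ≠ f Y.val := fun e => hXY (f.injective e)
  exact AddSubgroup.subset_closure (fiveTerm_mem_dilogRelators (hf _) (hf _) hx0 hx1 hy0 hy1 hxy)

/-! ## §3 Embeddings of a subfield of `ℚ̄ ⊆ ℂ` extend to `ℚ̄` -/

/-- An element of an intermediate field of `ℚ̄ ⊆ ℂ` is algebraic over `ℚ`. [folklore] -/
theorem isAlgebraic_of_mem_subfield (K : IntermediateField ℚ ↥(algebraicClosure ℚ ℂ)) (x : K) : IsAlgebraic ℚ x := by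
  have h1 : IsAlgebraic ℚ ((x : ↥(algebraicClosure ℚ ℂ)) : ℂ) := mem_algebraicClosure_iff.1 (x : ↥(algebraicClosure ℚ ℂ)).2
  have h2 : IsAlgebraic ℚ (x : ↥(algebraicClosure ℚ ℂ)) := IntermediateField.isAlgebraic_iff.2 h1
  exact IntermediateField.isAlgebraic_iff.2 h2

/-- Every ring embedding `σ : K → ℂ` of an intermediate field `K` of `ℚ̄ ⊆ ℂ` (a normal extension
of `ℚ`) is the restriction of a `ℚ`-algebra map `ℚ̄ → ℂ` (`AlgHom.liftNormal`). [folklore] -/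
theorem exists_algHom_extending (K : IntermediateField ℚ ↥(algebraicClosure ℚ ℂ)) (σ : K →+* ℂ) :
    ∃ τ : ↥(algebraicClosure ℚ ℂ) →ₐ[ℚ] ℂ, ∀ x : K, τ (x : ↥(algebraicClosure ℚ ℂ)) = σ x := by
  haveI : IsAlgClosure ℚ ↥(algebraicClosure ℚ ℂ) := algebraicClosure.isAlgClosure ℚ ℂ
  -- the image of `σ` consists of algebraic numbers
  have hmem : ∀ x : K, σ x ∈ (algebraicClosure ℚ ℂ) := fun x =>
    mem_algebraicClosure_iff.2 (by simpa using (isAlgebraic_of_mem_subfield K x).algHom σ.toRatAlgHom)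
  -- corestriction of `σ` to `ℚ̄`
  let ϕ : K →ₐ[ℚ] ↥(algebraicClosure ℚ ℂ) :=
    { toFun := fun x => ⟨σ x, hmem x⟩
      map_one' := Subtype.ext (by simp)
      map_mul' := fun a b => Subtype.ext (by simp)
      map_zero' := Subtype.ext (by simp)
      map_add' := fun a b => Subtype.ext (by simp)
      commutes' := fun q => Subtype.ext (by simp) }
  refine ⟨(IntermediateField.val _).comp (ϕ.liftNormal ↥(algebraicClosure ℚ ℂ)), fun x => ?_⟩
  have h := ϕ.liftNormal_commutes (↥(algebraicClosure ℚ ℂ)) x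
  rw [AlgHom.comp_apply]
  change (IntermediateField.val _) (ϕ.liftNormal (↥(algebraicClosure ℚ ℂ)) (algebraMap K (↥(algebraicClosure ℚ ℂ)) x)) = σ x
  rw [h]
  rfl

/-! ## §4 The descent -/

/-- **Descent to a number field** (stub `stub_numberFieldDescent` of line
`kummer-clausen-linearisation`, generation 2). Under the Borel–Suslin fact (Neumann 1998 Thm. 3.2):
if `ξ = Σ mᵢ[uᵢ]` (algebraic `uᵢ ∈ ℍ⁺`) has vanishing Dehn invariants `dehn φ ψ ξ = 0` and its
anti-symmetrised regulator `Σ mᵢ (D(σ uᵢ) − D(σ ūᵢ))` vanishes for every `ℚ`-algebra map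
`σ : ℚ̄ → ℂ`, then a positive multiple of `ξ` lies in `⟨dilogRelators⟩`.
[cite: Neumann1998, Thm. 3.2] -/
theorem stub_numberFieldDescent :
    Borel1977_blochGroup_regulator_kernel_torsion →
      ∀ (k : ℕ) (u : Fin k → ℂ) (m : Fin k → ℤ), (∀ i, IsAlgebraic ℚ (u i)) →
        (∀ i, 0 < (u i).im) →
        (∀ φ ψ : Additive ℂˣ →+ ℚ, dehn φ ψ (∑ i, m i • FreeAbelianGroup.of (u i)) = 0) →
        (∀ (σ : ↥(algebraicClosure ℚ ℂ) →ₐ[ℚ] ℂ) (w w' : Fin k → ↥(algebraicClosure ℚ ℂ)),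
          (∀ i, (w i : ℂ) = u i) → (∀ i, (w' i : ℂ) = conj (u i)) →
          ∑ i, (m i : ℝ) * (blochWignerDilog (σ (w i)) - blochWignerDilog (σ (w' i))) = 0) →
        ∃ n : ℕ, 0 < n ∧ n • (∑ i, m i • FreeAbelianGroup.of (u i)) ∈
          AddSubgroup.closure dilogRelators := by
  intro hBorel k u m hu him hA hB
  haveI : IsAlgClosure ℚ ↥(algebraicClosure ℚ ℂ) := algebraicClosure.isAlgClosure ℚ ℂ
  -- the points and their conjugates, in `ℚ̄`
  have hu0 : ∀ i, u i ≠ 0 := fun i h => (him i).ne' (by rw [h, Complex.zero_im])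
  have hu1 : ∀ i, u i ≠ 1 := fun i h => (him i).ne' (by rw [h, Complex.one_im])
  have huc : ∀ i, IsAlgebraic ℚ (conj (u i)) := fun i => by
    simpa using (hu i).algHom (starRingEnd ℂ).toRatAlgHom
  have hc0 : ∀ i, conj (u i) ≠ 0 := fun i => (map_ne_zero _).2 (hu0 i)
  have hc1 : ∀ i, conj (u i) ≠ 1 := fun i h =>
    hu1 i (by rw [← Complex.conj_conj (u i), h, map_one])
  let e : Fin k → ↥(algebraicClosure ℚ ℂ) := fun i => ⟨u i, mem_algebraicClosure_iff.2 (hu i)⟩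
  let e' : Fin k → ↥(algebraicClosure ℚ ℂ) := fun i => ⟨conj (u i), mem_algebraicClosure_iff.2 (huc i)⟩
  -- the number field `K = ℚ(uᵢ, ūᵢ) ⊆ ℚ̄`
  let S : Set ↥(algebraicClosure ℚ ℂ) := Set.range e ∪ Set.range e'
  let K : IntermediateField ℚ ↥(algebraicClosure ℚ ℂ) := IntermediateField.adjoin ℚ S
  haveI : Finite S := ((Set.finite_range e).union (Set.finite_range e')).to_subtype
  haveI hfd : FiniteDimensional ℚ K := IntermediateField.finiteDimensional_adjoin
    (fun x _ => (IntermediateField.isAlgebraic_iff.2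
      (mem_algebraicClosure_iff.1 x.2) : IsAlgebraic ℚ x).isIntegral)
  haveI : NumberField K := { to_charZero := inferInstance, to_finiteDimensional := hfd }
  have heK : ∀ i, e i ∈ K := fun i => IntermediateField.subset_adjoin ℚ S (Or.inl ⟨i, rfl⟩)
  have he'K : ∀ i, e' i ∈ K := fun i => IntermediateField.subset_adjoin ℚ S (Or.inr ⟨i, rfl⟩)
  -- the embedding `f : K → ℂ` and the generators `[uᵢ], [ūᵢ]` of `P(K)`
  let f : K →+* ℂ := (algebraMap ↥(algebraicClosure ℚ ℂ) ℂ).comp (algebraMap K ↥(algebraicClosure ℚ ℂ))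
  have hf : ∀ x : K, f x = ((x : ↥(algebraicClosure ℚ ℂ)) : ℂ) := fun x => rfl
  have hg : ∀ i, (⟨e i, heK i⟩ : K) ≠ 0 ∧ (⟨e i, heK i⟩ : K) ≠ 1 := fun i =>
    ⟨fun h => hu0 i (by simpa [e] using congrArg (fun x : K => ((x : ↥(algebraicClosure ℚ ℂ)) : ℂ)) h),
      fun h => hu1 i (by simpa [e] using congrArg (fun x : K => ((x : ↥(algebraicClosure ℚ ℂ)) : ℂ)) h)⟩
  have hg' : ∀ i, (⟨e' i, he'K i⟩ : K) ≠ 0 ∧ (⟨e' i, he'K i⟩ : K) ≠ 1 := fun i =>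
    ⟨fun h => hc0 i (by simpa [e'] using congrArg (fun x : K => ((x : ↥(algebraicClosure ℚ ℂ)) : ℂ)) h),
      fun h => hc1 i (by simpa [e'] using congrArg (fun x : K => ((x : ↥(algebraicClosure ℚ ℂ)) : ℂ)) h)⟩
  let g : Fin k → PreBloch.Gen K := fun i => ⟨⟨e i, heK i⟩, hg i⟩
  let g' : Fin k → PreBloch.Gen K := fun i => ⟨⟨e' i, he'K i⟩, hg' i⟩
  have hfg : ∀ i, f (g i).val = u i := fun i => rfl
  have hfg' : ∀ i, f (g' i).val = conj (u i) := fun i => rfl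
  let η : FreeAbelianGroup (PreBloch.Gen K) := ∑ i, m i • (of (g i) - of (g' i))
  -- (1) the Bloch condition for `η` from the Dehn hypothesis
  have hW : ∀ uK vK : Additive Kˣ →+ ℚ, PreBloch.wedgePairing uK vK η = 0 := by
    intro uK vK
    obtain ⟨φ, hφ⟩ := exists_character_extension f uK
    obtain ⟨ψ, hψ⟩ := exists_character_extension f vK
    have h1 : PreBloch.wedgePairing uK vK η = -dehn φ ψ (∑ i, m i • of (u i)) := by
      simp only [η, map_sum, map_zsmul, map_sub, wedgePairing_of_eq_neg_sym f hφ hψ, hfg, hfg',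
        dehn_of, asym, ← Finset.sum_neg_distrib]
      refine Finset.sum_congr rfl fun i _ => ?_
      ring
    rw [h1, hA φ ψ, neg_zero]
  -- (2) every regulator component of `η` vanishes, from the propagation hypothesis
  have hR : ∀ σ : K →+* ℂ, PreBloch.regulatorAt σ η = 0 := by
    intro σ
    obtain ⟨τ, hτ⟩ := exists_algHom_extending K σ
    have h := hB τ (fun i => ((g i).val : ↥(algebraicClosure ℚ ℂ))) (fun i => ((g' i).val : ↥(algebraicClosure ℚ ℂ))) (fun i => rfl)
      (fun i => rfl)
    simp only [hτ] at h
    simpa only [η, map_sum, map_zsmul, map_sub, PreBloch.regulatorAt_of, zsmul_eq_mul] using h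
  -- (3) the fact: `N • η` lies in the five-term span of `K`, which maps into `⟨dilogRelators⟩`
  obtain ⟨N, hN, hNη⟩ := hBorel K η hW hR
  have hmem : N • η ∈ AddSubgroup.closure (fiveTermRelators K) := by
    rw [← PreBloch.proj_eq_zero_iff, map_nsmul]
    exact hNη
  let ι : FreeAbelianGroup (PreBloch.Gen K) →+ FreeAbelianGroup ℂ :=
    FreeAbelianGroup.lift fun x => of (f x.val)
  have hι : ∀ x, ι (of x) = of (f x.val) := fun x => lift_apply_of _ _
  have hfa : ∀ x : K, IsAlgebraic ℚ (f x) := fun x => by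
    rw [hf, ← mem_algebraicClosure_iff]
    exact (x : ↥(algebraicClosure ℚ ℂ)).2
  have h3 := closure_fiveTerm_le_comap_of_embedding f hfa ι hι hmem
  rw [AddSubgroup.mem_comap, map_nsmul] at h3
  have hιη : ι η = ∑ i, m i • (of (u i) - of (conj (u i))) := by
    simp only [η, map_sum, map_zsmul, map_sub, hι, hfg, hfg']
  rw [hιη] at h3
  -- (4) `2ξ = η + Σ mᵢ([uᵢ] + [ūᵢ])`
  have hP : ∑ i, m i • (of (u i) + of (conj (u i))) ∈ AddSubgroup.closure dilogRelators :=
    AddSubgroup.sum_mem _ fun i _ => AddSubgroup.zsmul_mem _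
      (AddSubgroup.subset_closure (of_add_of_conj_mem_dilogRelators (hu i))) _
  have hsum : ∑ i, m i • (of (u i) - of (conj (u i))) + ∑ i, m i • (of (u i) + of (conj (u i))) =
      2 • ∑ i, m i • of (u i) := by
    rw [← Finset.sum_add_distrib, Finset.smul_sum]
    refine Finset.sum_congr rfl fun i _ => ?_
    rw [← zsmul_add, sub_add_add_cancel, ← two_nsmul, smul_comm]
  refine ⟨N * 2, by positivity, ?_⟩
  rw [mul_smul, ← hsum, smul_add]
  exact add_mem h3 (AddSubgroup.nsmul_mem _ hP _)

end Summit.KontsevichZagierPeriods.HyperbolicBloch.ZagierDilogarithm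

end
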